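import Summits.BirchSwinnertonDyer.BirchSwinnertonDyer.Theorems.LambdaTransportDoorAtTwoTowerAlgebra
import HarnessLib

/-!
# Cell bsd-rank2 (p2 GEN 66, part A): the MODULE ALGEBRA of the tower under the budget `λ ≤ 2` — no `ν_k`-torsion for
# `k ≥ 3`, the tower is constant from layer `2` on, and the LAYER-2 DICHOTOMY `rank X/ν₂X ∈ {0, 2}`

Cell-side file (cell bsd-rank2, HOME `run/shared/lean/pub/bsd-rank2/`, seat bsd-rank2-p2 GEN 66; memo `p2/g66/GEN66.md`;
namespace `Summit.BirchSwinnertonDyer.BirchSwinnertonDyer.Theorems.LambdaTransportDoorAtTwoTowerAlgebraBudgetTwo`). THEOREMS ONLY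
(no definition, no named fact, no instance, no `sorry`); pure algebra, no elliptic curve. The `λ ≤ 2` companion of GEN 61 part 2c
`…TowerAlgebra` (which needs `λ ≤ 4` AND `rank X/TX ≥ 2`); consumed by the class file `…MatsunoClassTowerLaw` on
`𝒞(15A8)` (`λ = 2`, members of every rank `0, 1, 2`).

THE POINT. `ω_n = (1+T)^{2^n} − 1 = T · (T+2) · ν₂ · ν₃ ⋯ ν_n`, `ν₂ = T² + 2T + 2`, `ν_k = ((1+T)^{2^{k−3}})^4 + 1` (`k ≥ 3`).
On `V = ℚ_p ⊗ X` with `dim V ≤ 2`: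
* `W = ker ν_k(T)` is `C`-stable (`C = (1+T)^{2^{k−3}}`) with `C⁴ = −1` on `W` and `dim W ≤ 2` — impossible over a field in which
  `−1, 2, −2` are non-squares unless `W = 0` (part 2c `eq_bot_of_pow_four_eq_neg`). So **no `ν_k`-torsion for `k ≥ 3` under
  `λ ≤ 2`, with NO hypothesis on `rank X/TX`** (`lambdaInvariant_quotient_pow_four_add_one_eq_zero_of_le_two`), and
  `rank X/ω_nX = rank X/ω_2X` for every `n ≥ 2` (`lambdaInvariant_quotient_omega_eq_layer_two_of_le_two`).
* `W₂ = ker ν₂(T)` is `T`-stable; a line `W₂` would carry an eigenvalue `c` of `T` with `c² + 2c + 2 = 0` — none in `ℚ_2`; so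
  `dim W₂ ∈ {0, 2}`, and `dim W₂ = 2` forces `W₂ = V`, `dim V = 2`, `ker T = ker (T+2) = 0` (`ν₂ ≡ 2` on both)
  (`ker_nu_two_dichotomy`, module form `lambdaInvariant_quotient_nu_two_dichotomy_of_le_two`): **the layer-2 jump is `0` or `2`,
  and it is `2` only when `rank X/TX = rank X/(T+2)X = 0` and `λ(X) = 2`.**

B1 honesty (director-bsd 2026-08-27): module algebra only; BSD is not touched; S0 does not move. PARTITION: none (algebra for
the r_an ≥ 2 cell, summit axis S0); TWIN (D-0056): n/a.

References: L. Washington, GTM 83 (1997) §13.1–13.3 (`ω_n`, `ν_n`, Prop. 13.8, Thm. 13.12, Lemma 13.14) [Washington1997];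
R. Greenberg, LNM 1716 (1999) Thm. 1.2, Thm. 1.9, §1 p. 65 [GreenbergLNM1716]; B. Mazur, Invent. Math. 18 (1972) §6 [Mazur1972].
-/

set_option linter.dupNamespace false

noncomputable section

open scoped MatrixGroups ModularForm TensorProduct
open PowerSeries CongruenceSubgroup WeierstrassCurve Literature.NumberTheory.EllipticCurves
  Literature.NumberTheory.EllipticCurves.ModularForms
  Literature.NumberTheory.EllipticCurves.IwasawaAlgebra
  Literature.NumberTheory.EllipticCurves.Rank1Residual
  Literature.NumberTheory.EllipticCurves.Rank1Residual.Typed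
  Literature.NumberTheory.EllipticCurves.Greenberg1999

universe u

namespace Summit.BirchSwinnertonDyer.BirchSwinnertonDyer.Theorems.LambdaTransportDoorAtTwoTowerAlgebraBudgetTwo

open Summit.BirchSwinnertonDyer.Rank2 Summit.BirchSwinnertonDyer.Rank2.Family81517
  Summit.BirchSwinnertonDyer.Rank2.LambdaTransportDoor
  Summit.BirchSwinnertonDyer.BirchSwinnertonDyer.Theorems.LambdaTransportDoorAtTwoLayerOne
  Summit.BirchSwinnertonDyer.BirchSwinnertonDyer.Theorems.LambdaTransportDoorAtTwoLayerTwoAlgebra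
  Summit.BirchSwinnertonDyer.BirchSwinnertonDyer.Theorems.LambdaTransportDoorAtTwoTowerAlgebra

/-! ### §1. Linear algebra in dimension `≤ 2` -/

section LinearAlgebra
variable {K V : Type*} [Field K] [AddCommGroup V] [Module K V] [FiniteDimensional K V]

/-- **`ker (C⁴ + 1) = 0` in dimension `≤ 2`.** `K` a field in which `−1, 2, −2` are non-squares; endomorphisms `C`, `N = C⁴ + 1`
(pointwise) of `V` with `dim V ≤ 2`. Then `ker N = 0`: `W = ker N` is `C`-stable, `dim W ≤ dim V ≤ 2`, `C⁴ = −1` on `W`, and part 2c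
§1 (`eq_bot_of_pow_four_eq_neg`) applies. With `C = (1+T)^{2^{k−3}}`, `N = ν_k(T)` (`k ≥ 3`) this is "no `ν_k`-torsion under
`λ ≤ 2`" — no hypothesis on `ker T`. [cite: Washington1997, §13.2–13.3] [cite: GreenbergLNM1716, §1 p. 65] -/
theorem ker_pow_four_add_one_eq_bot_of_finrank_le_two (h1 : ∀ c : K, c * c ≠ -1) (h2 : ∀ c : K, c * c ≠ 2)
    (h3 : ∀ c : K, c * c ≠ -2) (C N : Module.End K V) (hN : ∀ v, N v = C (C (C (C v))) + v)
    (hV : Module.finrank K V ≤ 2) : LinearMap.ker N = ⊥ := by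
  set W := LinearMap.ker N with hWdef
  have hCW : ∀ w ∈ W, C w ∈ W := fun w hw ↦ by
    rw [hWdef, LinearMap.mem_ker] at hw ⊢
    rw [hN] at hw ⊢
    have : C (C (C (C (C w))) + w) = 0 := by rw [hw, map_zero]
    simpa only [map_add] using this
  have hdim : Module.finrank K W ≤ 2 := (Submodule.finrank_le W).trans hV
  have hC4 : ∀ w ∈ W, C (C (C (C w))) = -w := fun w hw ↦ by
    rw [hWdef, LinearMap.mem_ker, hN] at hw
    exact eq_neg_of_add_eq_zero_left hw
  exact eq_bot_of_pow_four_eq_neg h1 h2 h3 C W hCW hdim hC4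

/-- **THE LAYER-2 DICHOTOMY in dimension `≤ 2`.** `K` a field with `2 ≠ 0` in which `c² + 2c + 2` has no root; endomorphisms `A`,
`N = A² + 2A + 2` (pointwise) of `V` with `dim V ≤ 2`. Then EITHER `ker N = 0`, OR `dim ker N = dim V = 2` and
`ker A = ker (A + 2) = 0`: a non-zero `w ∈ ker N` and `A w` are independent (else `A w = c w`, `c² + 2c + 2 = 0`), so `ker N = V`;
and `N ≡ 2` on `ker A` and on `ker (A + 2)`. [cite: Washington1997, §13.2 (Thm. 13.12)] [cite: GreenbergLNM1716, §1 p. 65] -/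
theorem ker_nu_two_dichotomy (A N : Module.End K V) (h2 : (2 : K) ≠ 0) (hK : ∀ c : K, c * c + 2 * c + 2 ≠ 0)
    (hN : ∀ v, N v = A (A v) + (2 : K) • A v + (2 : K) • v) (hV : Module.finrank K V ≤ 2) :
    LinearMap.ker N = ⊥ ∨
      (Module.finrank K (LinearMap.ker N) = 2 ∧ Module.finrank K V = 2 ∧ LinearMap.ker A = ⊥ ∧
        LinearMap.ker (A + algebraMap K (Module.End K V) 2) = ⊥) := by
  by_cases hW : LinearMap.ker N = ⊥
  · exact Or.inl hW
  right
  set W := LinearMap.ker N with hWdef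
  -- `W` is `A`-stable
  have hAW : ∀ w ∈ W, A w ∈ W := fun w hw ↦ by
    rw [hWdef, LinearMap.mem_ker] at hw ⊢
    rw [hN] at hw ⊢
    have : A (A (A w) + (2 : K) • A w + (2 : K) • w) = 0 := by rw [hw, map_zero]
    simpa only [map_add, map_smul] using this
  -- `dim W ≥ 2`: a nonzero `w ∈ W` and `A w` are independent (`ν₂` has no root in `K`)
  obtain ⟨w, hwW, hw0⟩ := (Submodule.ne_bot_iff W).mp hW
  have hli : LinearIndependent K ![w, A w] := by
    refine LinearIndependent.pair_iff.mpr fun s t hst ↦ ?_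
    by_cases ht : t = 0
    · subst ht
      rw [zero_smul, add_zero] at hst
      exact ⟨(smul_eq_zero.mp hst).resolve_right hw0, rfl⟩
    · exfalso
      have hAw : A w = (-s / t) • w := by
        have : t • A w = -(s • w) := eq_neg_of_add_eq_zero_right hst
        calc A w = t⁻¹ • (t • A w) := by rw [smul_smul, inv_mul_cancel₀ ht, one_smul]
          _ = (-s / t) • w := by rw [this, smul_neg, smul_smul, ← neg_smul, neg_div, div_eq_inv_mul]
      have hNw : N w = 0 := by rwa [hWdef, LinearMap.mem_ker] at hwW
      rw [hN, hAw, map_smul, hAw, smul_smul, smul_smul, ← add_smul, ← add_smul] at hNw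
      exact hK (-s / t) (by
        have := (smul_eq_zero.mp hNw).resolve_right hw0
        linear_combination this)
  have h2W : 2 ≤ Module.finrank K W := by
    have hspan : Submodule.span K (Set.range ![w, A w]) ≤ W := by
      rw [Submodule.span_le]
      rintro _ ⟨i, rfl⟩
      fin_cases i
      · exact hwW
      · exact hAW w hwW
    calc 2 = Fintype.card (Fin 2) := (Fintype.card_fin 2).symm
      _ = Module.finrank K (Submodule.span K (Set.range ![w, A w])) := (finrank_span_eq_card hli).symm
      _ ≤ Module.finrank K W := Submodule.finrank_mono hspan
  have hWle : Module.finrank K W ≤ Module.finrank K V := Submodule.finrank_le W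
  have hkW : Module.finrank K W = 2 := by omega
  have hV2 : Module.finrank K V = 2 := by omega
  have htop : W = ⊤ := Submodule.eq_top_of_finrank_eq (by rw [hkW, hV2])
  have hNall : ∀ v, A (A v) + (2 : K) • A v + (2 : K) • v = 0 := fun v ↦ by
    rw [← hN]
    have hv : v ∈ W := by rw [htop]; exact Submodule.mem_top
    rwa [hWdef, LinearMap.mem_ker] at hv
  refine ⟨hkW, hV2, ?_, ?_⟩
  · rw [Submodule.eq_bot_iff]
    intro v hv
    rw [LinearMap.mem_ker] at hv
    have h := hNall v
    rw [hv, map_zero, smul_zero, zero_add, zero_add] at h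
    exact (smul_eq_zero.mp h).resolve_left h2
  · rw [Submodule.eq_bot_iff]
    intro v hv
    rw [LinearMap.mem_ker, LinearMap.add_apply, Module.algebraMap_end_apply] at hv
    have hAv : A v = -((2 : K) • v) := eq_neg_of_add_eq_zero_left hv
    have h := hNall v
    rw [hAv, map_neg, map_smul, hAv, smul_neg, neg_neg, add_neg_cancel, zero_add] at h
    exact (smul_eq_zero.mp h).resolve_left h2

end LinearAlgebra

/-! ### §2. Module level: no `ν_k`-torsion for `k ≥ 3` and a constant tower from layer `2` on, under `λ ≤ 2` -/

section Module3

variable {p : ℕ} [Fact p.Prime] {M : Type u} [AddCommGroup M] [Module (IwasawaAlgebra p) M]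
  [Module.Finite (IwasawaAlgebra p) M]

/-- **NO `ν_k`-TORSION UNDER `λ ≤ 2` (module form).** `Λ = ℤ_p⟦T⟧` with `−1, 2, −2` non-squares in `ℚ_p` (e.g. `p = 2`); `X` a
finitely generated torsion `Λ`-module with `λ(X) ≤ 2` — NO hypothesis on `rank X/TX`. Then for every `m`,
`rank_{ℤ_p} X/(((1+T)^m)^4 + 1)X = 0`; in particular for `ν_k = ((1+T)^{2^{k−3}})^4 + 1`, `k ≥ 3`. (§1 on `V = ℚ_p ⊗ X` via
`…LayerOne.lambdaInvariant_quotient_eq_finrank_ker`.) [cite: GreenbergLNM1716, Thm. 1.2, §1 p. 65]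
[cite: Washington1997, §13.2–13.3 (`ω_n`, `ν_n`)] -/
theorem lambdaInvariant_quotient_pow_four_add_one_eq_zero_of_le_two (h1 : ∀ c : ℚ_[p], c * c ≠ -1)
    (h2 : ∀ c : ℚ_[p], c * c ≠ 2) (h3 : ∀ c : ℚ_[p], c * c ≠ -2) (hM : Module.IsTorsion (IwasawaAlgebra p) M)
    (hl : lambdaInvariant p M ≤ 2) (m : ℕ) :
    lambdaInvariant p (M ⧸ (Ideal.span {(((1 + PowerSeries.X) ^ m) ^ 4 + 1 : IwasawaAlgebra p)} •
      (⊤ : Submodule (IwasawaAlgebra p) M))) = 0 := by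
  letI : Module ℤ_[p] M := Module.compHom M (algebraMap ℤ_[p] (IwasawaAlgebra p))
  haveI : IsScalarTower ℤ_[p] (IwasawaAlgebra p) M := IsScalarTower.of_compHom ℤ_[p] _ _
  haveI : Module.Flat ℤ_[p] ℚ_[p] := IsLocalization.flat ℚ_[p] (nonZeroDivisors ℤ_[p])
  haveI : Module.Finite ℚ_[p] (ℚ_[p] ⊗[ℤ_[p]] M) := finite_baseChange_of_isTorsion p hM
  let L : IwasawaAlgebra p → (M →ₗ[ℤ_[p]] M) := fun a ↦
    (DistribSMul.toLinearMap (IwasawaAlgebra p) M a).restrictScalars ℤ_[p]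
  have hLmul : ∀ a b : IwasawaAlgebra p, L (a * b) = L a * L b := fun a b ↦ by
    ext x
    change (a * b) • x = a • b • x
    rw [mul_smul]
  have hLadd : ∀ a b : IwasawaAlgebra p, L (a + b) = L a + L b := fun a b ↦ by
    ext x
    change (a + b) • x = a • x + b • x
    rw [add_smul]
  have hLone : L 1 = 1 := by
    ext x
    change (1 : IwasawaAlgebra p) • x = x
    rw [one_smul]
  have hLpow : ∀ (a : IwasawaAlgebra p) (k : ℕ), L (a ^ k) = L a ^ k := fun a k ↦ by
    induction k with
    | zero => rw [pow_zero, pow_zero, hLone]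
    | succ k ih => rw [pow_succ, pow_succ, hLmul, ih]
  have hbcpow : ∀ (f : M →ₗ[ℤ_[p]] M) (k : ℕ), (f ^ k).baseChange ℚ_[p] = f.baseChange ℚ_[p] ^ k := fun f k ↦ by
    induction k with
    | zero => rw [pow_zero, pow_zero, LinearMap.baseChange_one]
    | succ k ih => rw [pow_succ, pow_succ, LinearMap.baseChange_mul, ih]
  set C : Module.End ℚ_[p] (ℚ_[p] ⊗[ℤ_[p]] M) := (L ((1 + PowerSeries.X) ^ m)).baseChange ℚ_[p] with hCdef
  set N : Module.End ℚ_[p] (ℚ_[p] ⊗[ℤ_[p]] M) :=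
    (L ((((1 + PowerSeries.X) ^ m) ^ 4 + 1))).baseChange ℚ_[p] with hNdef
  have hNC : N = C ^ 4 + 1 := by
    rw [hNdef, hLadd, hLone, hLpow, LinearMap.baseChange_add, LinearMap.baseChange_one, hbcpow]
  have hN : ∀ v, N v = C (C (C (C v))) + v := fun v ↦ by
    rw [hNC, LinearMap.add_apply, Module.End.one_apply]
    simp only [pow_succ, pow_zero, one_mul, Module.End.mul_apply]
  have hV : lambdaInvariant p M = Module.finrank ℚ_[p] (ℚ_[p] ⊗[ℤ_[p]] M) := lambdaInvariant_eq_finrank_tensorProduct M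
  have hker := ker_pow_four_add_one_eq_bot_of_finrank_le_two h1 h2 h3 C N hN (by rw [← hV]; exact hl)
  have h := lambdaInvariant_quotient_eq_finrank_ker hM ((((1 + PowerSeries.X) ^ m) ^ 4 + 1 : IwasawaAlgebra p))
  change lambdaInvariant p _ = Module.finrank ℚ_[p] (LinearMap.ker N) at h
  rw [h, hker, finrank_bot]

/-- **THE TOWER IS CONSTANT FROM LAYER 2 ON, UNDER `λ ≤ 2` (module form).** Same hypotheses; for every `n ≥ 2`:
`rank_{ℤ_p} X/ω_nX = rank_{ℤ_p} X/ω_2X`, `ω_n = (1+T)^{2^n} − 1` — induction on `n` with `ω_{n+1} = ν_{n+1} · ω_n`,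
`ν_{n+1} = ((1+T)^{2^{n−2}})^4 + 1` injective on `ℚ_p ⊗ X`. [cite: GreenbergLNM1716, Thm. 1.2, Thm. 1.9]
[cite: Washington1997, §13.3 (Lemma 13.14ff)] -/
theorem lambdaInvariant_quotient_omega_eq_layer_two_of_le_two (h1 : ∀ c : ℚ_[p], c * c ≠ -1)
    (h2 : ∀ c : ℚ_[p], c * c ≠ 2) (h3 : ∀ c : ℚ_[p], c * c ≠ -2) (hM : Module.IsTorsion (IwasawaAlgebra p) M)
    (hl : lambdaInvariant p M ≤ 2) {n : ℕ} (hn : 2 ≤ n) :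
    lambdaInvariant p (M ⧸ (Ideal.span {((1 + PowerSeries.X) ^ (2 ^ n) - 1 : IwasawaAlgebra p)} •
      (⊤ : Submodule (IwasawaAlgebra p) M))) =
    lambdaInvariant p (M ⧸ (Ideal.span {((1 + PowerSeries.X) ^ (2 ^ 2) - 1 : IwasawaAlgebra p)} •
      (⊤ : Submodule (IwasawaAlgebra p) M))) := by
  letI : Module ℤ_[p] M := Module.compHom M (algebraMap ℤ_[p] (IwasawaAlgebra p))
  haveI : IsScalarTower ℤ_[p] (IwasawaAlgebra p) M := IsScalarTower.of_compHom ℤ_[p] _ _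
  haveI : Module.Flat ℤ_[p] ℚ_[p] := IsLocalization.flat ℚ_[p] (nonZeroDivisors ℤ_[p])
  haveI : Module.Finite ℚ_[p] (ℚ_[p] ⊗[ℤ_[p]] M) := finite_baseChange_of_isTorsion p hM
  let L : IwasawaAlgebra p → (M →ₗ[ℤ_[p]] M) := fun a ↦
    (DistribSMul.toLinearMap (IwasawaAlgebra p) M a).restrictScalars ℤ_[p]
  have hLmul : ∀ a b : IwasawaAlgebra p, L (a * b) = L a * L b := fun a b ↦ by
    ext x
    change (a * b) • x = a • b • x
    rw [mul_smul]
  have hk : ∀ a : IwasawaAlgebra p, lambdaInvariant p (M ⧸ (Ideal.span {a} • (⊤ : Submodule (IwasawaAlgebra p) M))) =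
      Module.finrank ℚ_[p] (LinearMap.ker ((L a).baseChange ℚ_[p])) := fun a ↦
    lambdaInvariant_quotient_eq_finrank_ker hM a
  induction n, hn using Nat.le_induction with
  | base => rfl
  | succ n hn ih =>
    obtain ⟨k, rfl⟩ := Nat.exists_eq_add_of_le hn
    have hfac : ((1 + PowerSeries.X) ^ (2 ^ (2 + k + 1)) - 1 : IwasawaAlgebra p) =
        ((((1 + PowerSeries.X) ^ (2 ^ k)) ^ 4 + 1) * ((1 + PowerSeries.X) ^ (2 ^ (2 + k)) - 1)) := by
      rw [← pow_mul]
      ring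
    have hinj : LinearMap.ker ((L ((((1 + PowerSeries.X) ^ (2 ^ k)) ^ 4 + 1))).baseChange ℚ_[p]) = ⊥ := by
      rw [← Submodule.finrank_eq_zero, ← hk]
      exact lambdaInvariant_quotient_pow_four_add_one_eq_zero_of_le_two h1 h2 h3 hM hl (2 ^ k)
    rw [← ih, hk, hk, hfac, hLmul, LinearMap.baseChange_mul, Module.End.mul_eq_comp,
      LinearMap.ker_comp_of_ker_eq_bot _ hinj]

/-- **`rank_{ℤ_p} X/ν_kX = 0` for `k ≥ 3` under `λ ≤ 2`**, with `ν_k = (1+T)^{2^{k−1}} + 1` written as the layer factor.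
[cite: GreenbergLNM1716, Thm. 1.2, §1 p. 65] [cite: Washington1997, §13.2–13.3] -/
theorem lambdaInvariant_quotient_nu_eq_zero_of_le_two (h1 : ∀ c : ℚ_[p], c * c ≠ -1)
    (h2 : ∀ c : ℚ_[p], c * c ≠ 2) (h3 : ∀ c : ℚ_[p], c * c ≠ -2) (hM : Module.IsTorsion (IwasawaAlgebra p) M)
    (hl : lambdaInvariant p M ≤ 2) {k : ℕ} (hk : 3 ≤ k) :
    lambdaInvariant p (M ⧸ (Ideal.span {((1 + PowerSeries.X) ^ (2 ^ (k - 1)) + 1 : IwasawaAlgebra p)} •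
      (⊤ : Submodule (IwasawaAlgebra p) M))) = 0 := by
  obtain ⟨m, rfl⟩ := Nat.exists_eq_add_of_le hk
  have h24 : (2 : ℕ) ^ (3 + m - 1) = 2 ^ m * 4 := by
    rw [show 3 + m - 1 = m + 2 by omega, pow_add]
    norm_num
  rw [h24, pow_mul]
  exact lambdaInvariant_quotient_pow_four_add_one_eq_zero_of_le_two h1 h2 h3 hM hl (2 ^ m)

end Module3

/-! ### §3. Module level: the layer-2 dichotomy under `λ ≤ 2` -/

section Module2

variable {p : ℕ} [Fact p.Prime] {M : Type u} [AddCommGroup M] [Module (IwasawaAlgebra p) M]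
  [Module.Finite (IwasawaAlgebra p) M]

/-- **THE LAYER-2 DICHOTOMY UNDER `λ ≤ 2` (module form).** `Λ = ℤ_p⟦T⟧`, `ν₂ = T² + 2T + 2` without root in `ℚ_p` (e.g. `p = 2`);
`X` a finitely generated torsion `Λ`-module with `λ(X) ≤ 2`. Then EITHER `rank_{ℤ_p} X/ν₂X = 0`, OR `rank_{ℤ_p} X/ν₂X = 2 = λ(X)`
and `rank_{ℤ_p} X/TX = rank_{ℤ_p} X/(T+2)X = 0` — §1 on `V = ℚ_p ⊗ X`. So the jump of the coinvariant rank at the second layer of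
the `ℤ_p`-tower is `0` or `2`, and a jump exhausts the budget away from BOTH fixed points `T = 0`, `T = −2`.
[cite: GreenbergLNM1716, Thm. 1.2, §1 p. 65] [cite: Washington1997, §13.2 (Thm. 13.12, Prop. 13.8)] -/
theorem lambdaInvariant_quotient_nu_two_dichotomy_of_le_two (hK : ∀ c : ℚ_[p], c * c + 2 * c + 2 ≠ 0)
    (hM : Module.IsTorsion (IwasawaAlgebra p) M) (hl : lambdaInvariant p M ≤ 2) :
    lambdaInvariant p (M ⧸ (Ideal.span {(PowerSeries.X * PowerSeries.X + PowerSeries.C (2 : ℤ_[p]) * PowerSeries.X +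
        PowerSeries.C (2 : ℤ_[p]) : IwasawaAlgebra p)} • (⊤ : Submodule (IwasawaAlgebra p) M))) = 0 ∨
    (lambdaInvariant p (M ⧸ (Ideal.span {(PowerSeries.X * PowerSeries.X + PowerSeries.C (2 : ℤ_[p]) * PowerSeries.X +
        PowerSeries.C (2 : ℤ_[p]) : IwasawaAlgebra p)} • (⊤ : Submodule (IwasawaAlgebra p) M))) = 2 ∧
      lambdaInvariant p M = 2 ∧ coinvariantsRank p M = 0 ∧
      lambdaInvariant p (M ⧸ (Ideal.span {(PowerSeries.X + PowerSeries.C (2 : ℤ_[p]) : IwasawaAlgebra p)} •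
        (⊤ : Submodule (IwasawaAlgebra p) M))) = 0) := by
  letI : Module ℤ_[p] M := Module.compHom M (algebraMap ℤ_[p] (IwasawaAlgebra p))
  haveI : IsScalarTower ℤ_[p] (IwasawaAlgebra p) M := IsScalarTower.of_compHom ℤ_[p] _ _
  haveI : Module.Flat ℤ_[p] ℚ_[p] := IsLocalization.flat ℚ_[p] (nonZeroDivisors ℤ_[p])
  haveI : Module.Finite ℚ_[p] (ℚ_[p] ⊗[ℤ_[p]] M) := finite_baseChange_of_isTorsion p hM
  let L : IwasawaAlgebra p → (M →ₗ[ℤ_[p]] M) := fun a ↦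
    (DistribSMul.toLinearMap (IwasawaAlgebra p) M a).restrictScalars ℤ_[p]
  have hLmul : ∀ a b : IwasawaAlgebra p, L (a * b) = L a * L b := fun a b ↦ by
    ext x
    change (a * b) • x = a • b • x
    rw [mul_smul]
  have hLadd : ∀ a b : IwasawaAlgebra p, L (a + b) = L a + L b := fun a b ↦ by
    ext x
    change (a + b) • x = a • x + b • x
    rw [add_smul]
  have hLC : L (PowerSeries.C (2 : ℤ_[p])) = algebraMap ℤ_[p] (Module.End ℤ_[p] M) 2 := by
    ext x
    rw [Module.algebraMap_end_apply]
    change (PowerSeries.C (2 : ℤ_[p]) : IwasawaAlgebra p) • x = (algebraMap ℤ_[p] (IwasawaAlgebra p) 2) • x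
    rfl
  set A : Module.End ℚ_[p] (ℚ_[p] ⊗[ℤ_[p]] M) := (L PowerSeries.X).baseChange ℚ_[p] with hA
  have h2bc : (algebraMap ℤ_[p] (Module.End ℤ_[p] M) 2).baseChange ℚ_[p] =
      algebraMap ℚ_[p] (Module.End ℚ_[p] (ℚ_[p] ⊗[ℤ_[p]] M)) 2 := by
    rw [map_ofNat, map_ofNat, ← one_add_one_eq_two, LinearMap.baseChange_add, LinearMap.baseChange_one, one_add_one_eq_two]
  have hA2 : (L (PowerSeries.X + PowerSeries.C (2 : ℤ_[p]))).baseChange ℚ_[p] =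
      A + algebraMap ℚ_[p] (Module.End ℚ_[p] (ℚ_[p] ⊗[ℤ_[p]] M)) 2 := by
    rw [hLadd, LinearMap.baseChange_add, hLC, h2bc]
  set N : Module.End ℚ_[p] (ℚ_[p] ⊗[ℤ_[p]] M) := (L (PowerSeries.X * PowerSeries.X + PowerSeries.C (2 : ℤ_[p]) *
    PowerSeries.X + PowerSeries.C (2 : ℤ_[p]))).baseChange ℚ_[p] with hN
  have hNeq : N = A * A + algebraMap ℚ_[p] (Module.End ℚ_[p] (ℚ_[p] ⊗[ℤ_[p]] M)) 2 * A +
      algebraMap ℚ_[p] (Module.End ℚ_[p] (ℚ_[p] ⊗[ℤ_[p]] M)) 2 := by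
    rw [hN, hLadd, hLadd, hLmul, hLmul, LinearMap.baseChange_add, LinearMap.baseChange_add, LinearMap.baseChange_mul,
      LinearMap.baseChange_mul, hLC, h2bc]
  have hNA : ∀ v, N v = A (A v) + (2 : ℚ_[p]) • A v + (2 : ℚ_[p]) • v := fun v ↦ by
    rw [hNeq, LinearMap.add_apply, LinearMap.add_apply, Module.End.mul_apply, Module.End.mul_apply,
      Module.algebraMap_end_apply, Module.algebraMap_end_apply]
  -- the ranks as dimensions on `V`
  have hV : lambdaInvariant p M = Module.finrank ℚ_[p] (ℚ_[p] ⊗[ℤ_[p]] M) := lambdaInvariant_eq_finrank_tensorProduct M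
  have hT' : coinvariantsRank p M = Module.finrank ℚ_[p] (LinearMap.ker A) := by
    rw [coinvariantsRank_eq_lambdaInvariant]
    exact lambdaInvariant_quotient_eq_finrank_ker hM (PowerSeries.X : IwasawaAlgebra p)
  have hX2 : lambdaInvariant p (M ⧸ (Ideal.span {(PowerSeries.X + PowerSeries.C (2 : ℤ_[p]) : IwasawaAlgebra p)} •
      (⊤ : Submodule (IwasawaAlgebra p) M))) =
      Module.finrank ℚ_[p] (LinearMap.ker (A + algebraMap ℚ_[p] (Module.End ℚ_[p] (ℚ_[p] ⊗[ℤ_[p]] M)) 2)) := by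
    rw [← hA2]
    exact lambdaInvariant_quotient_eq_finrank_ker hM (PowerSeries.X + PowerSeries.C (2 : ℤ_[p]) : IwasawaAlgebra p)
  have hNu : lambdaInvariant p (M ⧸ (Ideal.span {(PowerSeries.X * PowerSeries.X + PowerSeries.C (2 : ℤ_[p]) *
      PowerSeries.X + PowerSeries.C (2 : ℤ_[p]) : IwasawaAlgebra p)} • (⊤ : Submodule (IwasawaAlgebra p) M))) =
      Module.finrank ℚ_[p] (LinearMap.ker N) :=
    lambdaInvariant_quotient_eq_finrank_ker hM _
  rcases ker_nu_two_dichotomy A N two_ne_zero hK hNA (by rw [← hV]; exact hl) with h0 | ⟨hkN, hV2, hkA, hk2⟩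
  · left
    rw [hNu, h0, finrank_bot]
  · right
    exact ⟨by rw [hNu, hkN], by rw [hV, hV2], by rw [hT', hkA, finrank_bot], by rw [hX2, hk2, finrank_bot]⟩

/-- **THE SECOND LAYER UNDER `λ ≤ 2` at `p = 2`: `rank_{ℤ_2} X/ω_2X = rank X/TX + rank X/(T+2)X + rank X/ν₂X ≤ 2`**, with
`ω_2 = (1+T)^4 − 1 = T (T+2) ν₂` (`…LayerTwoAlgebra.omega_two_eq`, `…lambdaInvariant_quotient_omega_one_mul_nu_two`,
`…LayerOne.lambdaInvariant_quotient_X_mul_X_add_two`), and the three summands are `(a, b, 0)` or `(0, 0, 2)`.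
[cite: GreenbergLNM1716, Thm. 1.2, §1 p. 65] [cite: Washington1997, §13.2 (`ω_n`)] -/
theorem lambdaInvariant_quotient_omega_two_eq_of_le_two {M : Type u} [AddCommGroup M] [Module (IwasawaAlgebra 2) M]
    [Module.Finite (IwasawaAlgebra 2) M] (hM : Module.IsTorsion (IwasawaAlgebra 2) M) (hl : lambdaInvariant 2 M ≤ 2) :
    lambdaInvariant 2 (M ⧸ (Ideal.span {((1 + PowerSeries.X) ^ (2 ^ 2) - 1 : IwasawaAlgebra 2)} •
        (⊤ : Submodule (IwasawaAlgebra 2) M))) =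
      coinvariantsRank 2 M +
        lambdaInvariant 2 (M ⧸ (Ideal.span {(PowerSeries.X + PowerSeries.C (2 : ℤ_[2]) : IwasawaAlgebra 2)} •
          (⊤ : Submodule (IwasawaAlgebra 2) M))) +
        lambdaInvariant 2 (M ⧸ (Ideal.span {(PowerSeries.X * PowerSeries.X + PowerSeries.C (2 : ℤ_[2]) * PowerSeries.X +
          PowerSeries.C (2 : ℤ_[2]) : IwasawaAlgebra 2)} • (⊤ : Submodule (IwasawaAlgebra 2) M))) ∧
    lambdaInvariant 2 (M ⧸ (Ideal.span {((1 + PowerSeries.X) ^ (2 ^ 2) - 1 : IwasawaAlgebra 2)} •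
        (⊤ : Submodule (IwasawaAlgebra 2) M))) ≤ 2 ∧
    (lambdaInvariant 2 (M ⧸ (Ideal.span {(PowerSeries.X * PowerSeries.X + PowerSeries.C (2 : ℤ_[2]) * PowerSeries.X +
          PowerSeries.C (2 : ℤ_[2]) : IwasawaAlgebra 2)} • (⊤ : Submodule (IwasawaAlgebra 2) M))) = 0 ∨
      (lambdaInvariant 2 (M ⧸ (Ideal.span {(PowerSeries.X * PowerSeries.X + PowerSeries.C (2 : ℤ_[2]) * PowerSeries.X +
          PowerSeries.C (2 : ℤ_[2]) : IwasawaAlgebra 2)} • (⊤ : Submodule (IwasawaAlgebra 2) M))) = 2 ∧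
        lambdaInvariant 2 M = 2 ∧ coinvariantsRank 2 M = 0 ∧
        lambdaInvariant 2 (M ⧸ (Ideal.span {(PowerSeries.X + PowerSeries.C (2 : ℤ_[2]) : IwasawaAlgebra 2)} •
          (⊤ : Submodule (IwasawaAlgebra 2) M))) = 0)) := by
  have hsplit := lambdaInvariant_quotient_omega_one_mul_nu_two (p := 2) (M := M) hM
  have hsplit1 := lambdaInvariant_quotient_X_mul_X_add_two (p := 2) (M := M) hM
  have hdich := lambdaInvariant_quotient_nu_two_dichotomy_of_le_two (p := 2) (M := M) padicTwo_nu_ne_zero hM hl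
  have heq : lambdaInvariant 2 (M ⧸ (Ideal.span {((1 + PowerSeries.X) ^ (2 ^ 2) - 1 : IwasawaAlgebra 2)} •
        (⊤ : Submodule (IwasawaAlgebra 2) M))) =
      coinvariantsRank 2 M +
        lambdaInvariant 2 (M ⧸ (Ideal.span {(PowerSeries.X + PowerSeries.C (2 : ℤ_[2]) : IwasawaAlgebra 2)} •
          (⊤ : Submodule (IwasawaAlgebra 2) M))) +
        lambdaInvariant 2 (M ⧸ (Ideal.span {(PowerSeries.X * PowerSeries.X + PowerSeries.C (2 : ℤ_[2]) * PowerSeries.X +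
          PowerSeries.C (2 : ℤ_[2]) : IwasawaAlgebra 2)} • (⊤ : Submodule (IwasawaAlgebra 2) M))) := by
    rw [omega_two_eq, hsplit, hsplit1]
  -- every quotient rank is at most `λ(X)`
  letI : Module ℤ_[2] M := Module.compHom M (algebraMap ℤ_[2] (IwasawaAlgebra 2))
  haveI : IsScalarTower ℤ_[2] (IwasawaAlgebra 2) M := IsScalarTower.of_compHom ℤ_[2] _ _
  haveI : Module.Flat ℤ_[2] ℚ_[2] := IsLocalization.flat ℚ_[2] (nonZeroDivisors ℤ_[2])
  haveI : Module.Finite ℚ_[2] (ℚ_[2] ⊗[ℤ_[2]] M) := finite_baseChange_of_isTorsion 2 hM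
  have hV : lambdaInvariant 2 M = Module.finrank ℚ_[2] (ℚ_[2] ⊗[ℤ_[2]] M) := lambdaInvariant_eq_finrank_tensorProduct M
  have hle : lambdaInvariant 2 (M ⧸ (Ideal.span {((1 + PowerSeries.X) ^ (2 ^ 2) - 1 : IwasawaAlgebra 2)} •
      (⊤ : Submodule (IwasawaAlgebra 2) M))) ≤ lambdaInvariant 2 M := by
    rw [lambdaInvariant_quotient_eq_finrank_ker hM ((1 + PowerSeries.X) ^ (2 ^ 2) - 1 : IwasawaAlgebra 2), hV]
    exact Submodule.finrank_le _
  exact ⟨heq, hle.trans hl, hdich⟩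

end Module2

end Summit.BirchSwinnertonDyer.BirchSwinnertonDyer.Theorems.LambdaTransportDoorAtTwoTowerAlgebraBudgetTwo
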